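import Summits.ABC.IUTFork.Joshi.TestThetaLociGenuineIsometric
import HarnessLib

/-!
# X-09 at GENUINE DATA, completion (R-J census row Y-11) — the HULL reading of Joshi's locus (locus := `^{n,∘}𝒰_{j,v_ℚ}`, the
# holomorphic hull of the multiradial orbit: the literal «Convex Closure» typing of [J-III] Thm-Def 9.8.1.1 (4)/(5))

Proof-only completion (0 definitions, 0 `Prop` facts, no `sorry`; abc-iut cell, block E / R-J census, rung LADDER-ABC:A2.E; seat
abc-iut-E-t22, gen 8) of the Y-11 family `Joshi/TestThetaLociGenuine{,Mover,Initial,Isometric}.lean` (p451250 / p453604 / p454054 /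
p455782), answering the referee lane's non-defect NOTE (abc-iut-E-ref g4, sheet `plan/E/ref/FAITHFUL-TestThetaLociGenuine.md` §3,
2026-08-26T16:48:47Z): «the most LITERAL typing of (4)/(5) — a HULL reading, locus := Convex Closure of the collation/orbit union — is
not one of the three named families … Authors MAY add a one-lemma `hull_reading` row for completeness». [J-III] (K. Joshi,
arXiv:2401.13508v4, unrefereed) Thm-Def 9.8.1.1 (4)/(5) p.116 defines `Θ̃^{Ĩ}_Mochizuki` as the CONVEX CLOSURE of `Ψ^{Mochizuki}`; OUR
typed hull object is abc-iut-c312-1's `P.thetaHull j vQ = (P.frame j vQ).hull (⋃₀ P.possibleImages j vQ)` ([IUTchIII] Cor. 3.12 proof,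
p.174 l.50 – p.175 l.1, «the holomorphic hull of the union of the possible images»). The HULL READING of a loci reading `R` is
`R.locusRegion j vQ = P.thetaHull j vQ` in every packet.

§1 INTERFACE (any lattice situation, setting, reading; logic only): under the hull reading the ⊇-half of «are» and the hull row hold
trivially (`possibleImagesWithinLocus_of_locus_eq_thetaHull`, `locusWithinHull_of_locus_eq_thetaHull`: orbit ⊆ hull, locus = hull),
and the identification-level ⊆-row holds IFF the orbit union is hull-closed, `^{n,∘}𝒰 = ⋃₀ possibleImages`
(`locusWithinPossibleImages_iff_of_locus_eq_thetaHull`) — the same content-free character as the orbit reading (p451250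
`both_iff_locus_eq_sUnion`): the row pins the locus to a typed object and says nothing toward S. The reading exists wherever the hulls are
non-empty (`exists_hullReading`). Inside rp-h3's `OrbitInside` with hull-set Θ-regions (rp-h1/rp-h3 `HThetaPolydisc`) the hull IS the
`m = 0` Kummer image at the labels of `𝔽_l^⋇` (rp-h3 `thetaHull_eq_thetaRegion`), so there hull reading = Θ-reading = orbit reading.
§2 GENUINE, ISOMETRIC HORN (abc-iut-E-t41's `honestSetting` with a norm-one-unit (Ind2) and trivial strip binder; in particular PRINT's
`Real.ismPrint` over `Real.logShellsIsm`): every Θ-region is a hull-set (`thetaRegion_mem_hul_honestSetting`, all labels incl. `0`), the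
orbit is trivial (p455782), hence `^{n,∘}𝒰_{j,v_ℚ}` IS the (Ind3)-region in EVERY packet (`thetaHull_honestSetting_of_unitIsm`) and the
hull reading has ALL THREE rows (`hullReading_all_honestSetting_of_unitIsm`, `…_ismPrint`; existence `exists_hullReading_all_…`).
§3 GENUINE, DH HORN (`settingPrVolSharp`, `Real.ismDH`): ⊇-half and hull row hold by §1; the ⊆-row is the hull-closedness of the
multiradial orbit union there — NOT decided here (located: under DH's (Ind2) the orbit is non-trivial, p453604/p454054, and whether
its union is a hull-set is a separate question; no claim).
**No side is taken** on [IUTchIII] Cor. 3.12 or on any author; typed ≠ proved; R13 DATA; located A1, not adjudicated.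
[claim: Joshi2024ATS3, status: disputed] [claim: Mochizuki2012, status: disputed] [cite: DupuyHilado2025, §4.7, §4.9]
-/

noncomputable section

open Set Function NumberField IsDedekindDomain
open scoped Pointwise

namespace Summit.ABC.IUTFork.Joshi

open Thm311 Thm311.Real Cor312 Cor312Vol Literature.IUT.LogThetaLattice Literature.IUT.LogVolume
open Summit.ABC.IUTFork.Repair.CandDupuyHilado32 (OrbitInside thetaHull_eq_thetaRegion)
open Summit.ABC.IUTFork.Repair.CandDupuyHilado30 (HThetaPolydisc)

/-! ## 1. Interface: the hull reading -/

section Interface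

variable {T : ThetaIndex} {S : LatticeSituation T} {P : Cor312.Setting S.toSituation}
  {W : Type} {V : W → Type} [∀ w, TopologicalSpace (V w)] {TJ TM : Type} [TopologicalSpace TJ] [TopologicalSpace TM]
  {C : ATS3.TensorPacketLociDatum W V TJ TM} {𝔇 : Dictionary S} (R : LociReading P C 𝔇)

/-- **Hull reading: the ⊇-half of «are» holds** (the orbit union lies in its hull). [folklore] -/
theorem possibleImagesWithinLocus_of_locus_eq_thetaHull (hH : ∀ (j : T.Label) (vQ : T.VQ), R.locusRegion j vQ = P.thetaHull j vQ) :
    R.PossibleImagesWithinLocus := fun j vQ => by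
  rw [hH]; exact (P.frame j vQ).subset_hull _

/-- **Hull reading: the hull row holds** (locus = hull). [folklore] -/
theorem locusWithinHull_of_locus_eq_thetaHull (hH : ∀ (j : T.Label) (vQ : T.VQ), R.locusRegion j vQ = P.thetaHull j vQ) :
    R.LocusWithinHull := fun _ vQ => (hH _ vQ).le

/-- **Hull reading: the identification-level ⊆-row holds IFF the multiradial orbit union is hull-closed** (`^{n,∘}𝒰 = ⋃₀ possible
images` in every packet) — a property of the typed objects, content-free toward S. [folklore] -/
theorem locusWithinPossibleImages_iff_of_locus_eq_thetaHull
    (hH : ∀ (j : T.Label) (vQ : T.VQ), R.locusRegion j vQ = P.thetaHull j vQ) :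
    R.LocusWithinPossibleImages ↔ ∀ (j : T.Label) (vQ : T.VQ), P.thetaHull j vQ = ⋃₀ P.possibleImages j vQ :=
  ⟨fun h j vQ => ((hH j vQ).ge.trans (h j vQ)).antisymm ((P.frame j vQ).subset_hull _),
    fun h j vQ => (hH j vQ).le.trans (h j vQ).le⟩

/-- Under the hull reading, BOTH halves of «are» ⟺ the orbit union is hull-closed (then hull reading = orbit reading). [folklore] -/
theorem both_iff_of_locus_eq_thetaHull (hH : ∀ (j : T.Label) (vQ : T.VQ), R.locusRegion j vQ = P.thetaHull j vQ) :
    (R.LocusWithinPossibleImages ∧ R.PossibleImagesWithinLocus) ↔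
      ∀ (j : T.Label) (vQ : T.VQ), P.thetaHull j vQ = ⋃₀ P.possibleImages j vQ :=
  ⟨fun h => (locusWithinPossibleImages_iff_of_locus_eq_thetaHull R hH).1 h.1,
    fun h => ⟨(locusWithinPossibleImages_iff_of_locus_eq_thetaHull R hH).2 h,
      possibleImagesWithinLocus_of_locus_eq_thetaHull R hH⟩⟩

/-- The hull reading EXISTS over any setting with non-empty hulls and any seed dictionary (E-t22's region signature p431723 on the
hulls). Non-vacuity device only. [folklore] -/
theorem exists_hullReading (𝔇 : Dictionary S) (hne : ∀ (j : T.Label) (vQ : T.VQ), (P.thetaHull j vQ).Nonempty) :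
    ∃ R : LociReading P (regionLoci S _ hne) 𝔇, ∀ (j : T.Label) (vQ : T.VQ), R.locusRegion j vQ = P.thetaHull j vQ :=
  ⟨regionReading S _ hne 𝔇, locusRegion_regionReading S _ hne 𝔇⟩

/-- A hull-set is its own hull. [folklore] -/
theorem hull_eq_self_of_mem_hul {X : Type} (F : HullFrame X) {H : Set X} (hH : H ∈ F.Hul) : F.hull H = H :=
  (F.hull_subset_of_mem hH Subset.rfl).antisymm (F.subset_hull H)

/-- **Inside `OrbitInside` with hull-set Θ-regions, `^{n,∘}𝒰_{j,v_ℚ}` IS the `m = 0` Kummer image at the labels of `𝔽_l^⋇`** (rp-h3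
`thetaHull_eq_thetaRegion`), so a hull reading agrees there with the Θ-region and the ⊆-row holds at those labels. [folklore] -/
theorem thetaHull_subset_sUnion_of_orbitInside (hΘ : HThetaPolydisc S P) (ho : OrbitInside S P) (i : Fin T.lstar) (vQ : T.VQ) :
    P.thetaHull (Setting.labelSucc i) vQ ⊆ ⋃₀ P.possibleImages (Setting.labelSucc i) vQ := by
  rw [thetaHull_eq_thetaRegion S P hΘ ho i vQ]
  exact (Set.subset_iUnion (fun m => P.thetaRegion m (Setting.labelSucc i) vQ) 0).trans (P.thetaRegion3_subset_sUnion _ vQ)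

end Interface

/-! ## 2. Genuine, isometric horn: at the honest setting under a unit (Ind2) the hull IS the (Ind3)-region, everywhere -/

section Honest

variable {F : Type} [Field F] [NumberField F] (X : PilotData F) {logv : PadicLogs F} (hlog : LogvAnalytic logv)
  {Aut Ism : ∀ x : Thm311.Real.Place F, Set (Thm311.Real.Carrier x ≃ₗ[ℚ] Thm311.Real.Carrier x)}
  (hAut : ∀ x, LinearEquiv.refl ℚ (Thm311.Real.Carrier x) ∈ Aut x) (hIsm : ∀ x, LinearEquiv.refl ℚ (Thm311.Real.Carrier x) ∈ Ism x)
  (M : Type) [Field M] [NumberField M]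
  (archPk : ∀ (j : (thetaIndex X).Label) (vQ : (thetaIndex X).VQ), Set ((logShells X logv Aut Ism hAut hIsm).Packet j vQ))
  (archSub : ∀ (j : (thetaIndex X).Label) (v : (thetaIndex X).V),
    Set ((logShells X logv Aut Ism hAut hIsm).Packet j ((thetaIndex X).over v)))
  (Ψ : ℤ → ∀ v : (thetaIndex X).V, v ∈ (thetaIndex X).Vbad → Set ((logShells X logv Aut Ism hAut hIsm).StarPacket v))
  (act : ℤ → ∀ v : (thetaIndex X).V, v ∈ (thetaIndex X).Vbad →
    (logShells X logv Aut Ism hAut hIsm).StarPacket v → Module.End ℚ ((logShells X logv Aut Ism hAut hIsm).StarPacket v))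
  (Mmod : ℤ → ∀ j : (thetaIndex X).LabelStar, Set ((logShells X logv Aut Ism hAut hIsm).GlobalPacket j.1))
  (region : ℤ → ∀ j : (thetaIndex X).LabelStar, FinDivisor M → ∀ vQ : (thetaIndex X).VQ,
    Set ((logShells X logv Aut Ism hAut hIsm).Packet j.1 vQ))
  (col : ℤ → Column (logShells X logv Aut Ism hAut hIsm)) (n : ℤ) (p : ℕ) [hp : Fact p.Prime]
  (hAutT : ∀ x, ∀ g ∈ Aut x, g = LinearEquiv.refl ℚ (Thm311.Real.Carrier x))
  (hIsmU : ∀ (pp : Nat.Primes) (x : (thetaIndex X).Fibre (.inr pp)), ∀ g ∈ Ism x.1,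
    haveI : Fact (pp : ℕ).Prime := ⟨pp.2⟩
    ∃ c : (presAt X hlog pp).k x, ‖c‖ = 1 ∧ ∀ a, (presAt X hlog pp).φ x (g a) = c * (presAt X hlog pp).φ x a)
  {W : Type} {V : W → Type} [∀ w, TopologicalSpace (V w)] {TJ TM : Type} [TopologicalSpace TJ] [TopologicalSpace TM]
  {C : ATS3.TensorPacketLociDatum W V TJ TM}

/-- **Every Θ-region of the honest setting is a hull-set of its (pulled-back real) frame** — `e⁻¹(p·𝒪_L)`, at EVERY label including
`0` (the clause `HThetaPolydisc` of rp-h1/rp-h3 at the labels of `𝔽_l^⋇`). [cite: Mochizuki2012, IUTchIII Rmk. 3.9.5 (ix) p. 128] -/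
theorem thetaRegion_mem_hul_honestSetting (m : ℤ) (j : (thetaIndex X).Label) (vQ : (thetaIndex X).VQ) :
    (honestSetting X hlog Aut Ism hAut hIsm M archPk archSub Ψ act Mmod region col n p).thetaRegion m j vQ ∈
      ((honestSetting X hlog Aut Ism hAut hIsm M archPk archSub Ψ act Mmod region col n p).frame j vQ).Hul :=
  ⟨_, ⟨fun s => (p : factorFieldDH X hlog j vQ s), natCast_prime_ne_zero_factorFieldDH X hlog p j vQ, rfl⟩, rfl⟩

/-- `HThetaPolydisc` holds at the honest setting (every binder). [cite: Mochizuki2012, IUTchIII Rmk. 3.9.5 (ix) p. 128] -/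
theorem thetaPolydisc_honestSetting :
    HThetaPolydisc (latticeSituationReal X hlog Aut Ism hAut hIsm M archPk archSub Ψ act Mmod region col)
      (honestSetting X hlog Aut Ism hAut hIsm M archPk archSub Ψ act Mmod region col n p) := fun m _ vQ =>
  thetaRegion_mem_hul_honestSetting X hlog hAut hIsm M archPk archSub Ψ act Mmod region col n p m _ vQ

include hAutT hIsmU

/-- **Under the unit (Ind2) `^{n,∘}𝒰_{j,v_ℚ}` IS the (Ind3)-region, in EVERY packet (label `0` included)**: the orbit union is the region
(p455782 `sUnion_possibleImages_honestSetting_of_unitIsm`), which is the hull-set `e⁻¹(p·𝒪_L)`, its own hull. [folklore] -/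
theorem thetaHull_honestSetting_of_unitIsm (j : (thetaIndex X).Label) (vQ : (thetaIndex X).VQ) :
    (honestSetting X hlog Aut Ism hAut hIsm M archPk archSub Ψ act Mmod region col n p).thetaHull j vQ =
      (honestSetting X hlog Aut Ism hAut hIsm M archPk archSub Ψ act Mmod region col n p).thetaRegion3 j vQ := by
  have h3 : (honestSetting X hlog Aut Ism hAut hIsm M archPk archSub Ψ act Mmod region col n p).thetaRegion3 j vQ =
      (honestSetting X hlog Aut Ism hAut hIsm M archPk archSub Ψ act Mmod region col n p).thetaRegion 0 j vQ :=
    Subset.antisymm (iUnion_subset fun _ => subset_of_eq rfl) fun x hx => Set.mem_iUnion.mpr ⟨0, hx⟩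
  rw [Setting.thetaHull, sUnion_possibleImages_honestSetting_of_unitIsm X hlog hAut hIsm M archPk archSub Ψ act Mmod region col n p
    hAutT hIsmU, h3]
  exact hull_eq_self_of_mem_hul _ (thetaRegion_mem_hul_honestSetting X hlog hAut hIsm M archPk archSub Ψ act Mmod region col n p 0 j vQ)

/-- Hence the orbit union is hull-closed there: `^{n,∘}𝒰 = ⋃₀ possibleImages` in every packet. [folklore] -/
theorem thetaHull_eq_sUnion_honestSetting_of_unitIsm (j : (thetaIndex X).Label) (vQ : (thetaIndex X).VQ) :
    (honestSetting X hlog Aut Ism hAut hIsm M archPk archSub Ψ act Mmod region col n p).thetaHull j vQ =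
      ⋃₀ (honestSetting X hlog Aut Ism hAut hIsm M archPk archSub Ψ act Mmod region col n p).possibleImages j vQ := by
  rw [thetaHull_honestSetting_of_unitIsm X hlog hAut hIsm M archPk archSub Ψ act Mmod region col n p hAutT hIsmU,
    sUnion_possibleImages_honestSetting_of_unitIsm X hlog hAut hIsm M archPk archSub Ψ act Mmod region col n p hAutT hIsmU]

/-- **ISOMETRIC HORN, HULL READING: ALL THREE rows hold** at the honest setting under the unit (Ind2) for every reading whose locus is
`^{n,∘}𝒰` in every packet — there hull reading = Θ-reading = orbit reading. J-TRUE-AT-GENUINE data (R13). [claim: Joshi2024ATS3, status: disputed] -/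
theorem hullReading_all_honestSetting_of_unitIsm
    {𝔇 : Dictionary (latticeSituationReal X hlog Aut Ism hAut hIsm M archPk archSub Ψ act Mmod region col)}
    (R : LociReading (honestSetting X hlog Aut Ism hAut hIsm M archPk archSub Ψ act Mmod region col n p) C 𝔇)
    (hH : ∀ (j : (thetaIndex X).Label) (vQ : (thetaIndex X).VQ), R.locusRegion j vQ =
      (honestSetting X hlog Aut Ism hAut hIsm M archPk archSub Ψ act Mmod region col n p).thetaHull j vQ) :
    R.LocusWithinPossibleImages ∧ R.PossibleImagesWithinLocus ∧ R.LocusWithinHull :=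
  ⟨(locusWithinPossibleImages_iff_of_locus_eq_thetaHull R hH).2
      (thetaHull_eq_sUnion_honestSetting_of_unitIsm X hlog hAut hIsm M archPk archSub Ψ act Mmod region col n p hAutT hIsmU),
    possibleImagesWithinLocus_of_locus_eq_thetaHull R hH, locusWithinHull_of_locus_eq_thetaHull R hH⟩

/-- … and such a reading EXISTS there (the hulls are the non-empty Θ-regions). [claim: Joshi2024ATS3, status: disputed] -/
theorem exists_hullReading_all_honestSetting_of_unitIsm
    (𝔇 : Dictionary (latticeSituationReal X hlog Aut Ism hAut hIsm M archPk archSub Ψ act Mmod region col)) :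
    ∃ (hne : ∀ (j : (thetaIndex X).Label) (vQ : (thetaIndex X).VQ),
        ((honestSetting X hlog Aut Ism hAut hIsm M archPk archSub Ψ act Mmod region col n p).thetaHull j vQ).Nonempty)
      (R : LociReading (honestSetting X hlog Aut Ism hAut hIsm M archPk archSub Ψ act Mmod region col n p)
        (regionLoci (latticeSituationReal X hlog Aut Ism hAut hIsm M archPk archSub Ψ act Mmod region col) _ hne) 𝔇),
      R.LocusWithinPossibleImages ∧ R.PossibleImagesWithinLocus ∧ R.LocusWithinHull := by
  have hne : ∀ (j : (thetaIndex X).Label) (vQ : (thetaIndex X).VQ),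
      ((honestSetting X hlog Aut Ism hAut hIsm M archPk archSub Ψ act Mmod region col n p).thetaHull j vQ).Nonempty := fun j vQ =>
    (thetaRegion3_honestSetting_nonempty X hlog hAut hIsm M archPk archSub Ψ act Mmod region col n p j vQ).mono
      (((honestSetting X hlog Aut Ism hAut hIsm M archPk archSub Ψ act Mmod region col n p).thetaRegion3_subset_sUnion j vQ).trans
        (((honestSetting X hlog Aut Ism hAut hIsm M archPk archSub Ψ act Mmod region col n p).frame j vQ).subset_hull _))
  obtain ⟨R, hR⟩ := exists_hullReading (P := honestSetting X hlog Aut Ism hAut hIsm M archPk archSub Ψ act Mmod region col n p) 𝔇 hne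
  exact ⟨hne, R, hullReading_all_honestSetting_of_unitIsm X hlog hAut hIsm M archPk archSub Ψ act Mmod region col n p hAutT hIsmU R hR⟩

end Honest

/-! ## 3. PRINT's (Ind2) `Real.ismPrint` over `Real.logShellsIsm` -/

section Print

variable {F : Type} [Field F] [NumberField F] (X : PilotData F) {logv : PadicLogs F} (hlog : LogvAnalytic logv)
  (M : Type) [Field M] [NumberField M]
  (archPk : ∀ (j : (thetaIndex X).Label) (vQ : (thetaIndex X).VQ), Set ((logShellsIsm X logv).Packet j vQ))
  (archSub : ∀ (j : (thetaIndex X).Label) (v : (thetaIndex X).V), Set ((logShellsIsm X logv).Packet j ((thetaIndex X).over v)))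
  (Ψ : ℤ → ∀ v : (thetaIndex X).V, v ∈ (thetaIndex X).Vbad → Set ((logShellsIsm X logv).StarPacket v))
  (act : ℤ → ∀ v : (thetaIndex X).V, v ∈ (thetaIndex X).Vbad →
    (logShellsIsm X logv).StarPacket v → Module.End ℚ ((logShellsIsm X logv).StarPacket v))
  (Mmod : ℤ → ∀ j : (thetaIndex X).LabelStar, Set ((logShellsIsm X logv).GlobalPacket j.1))
  (region : ℤ → ∀ j : (thetaIndex X).LabelStar, FinDivisor M → ∀ vQ : (thetaIndex X).VQ,
    Set ((logShellsIsm X logv).Packet j.1 vQ))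
  (col : ℤ → Column (logShellsIsm X logv)) (n : ℤ) (p : ℕ) [hp : Fact p.Prime]
  {W : Type} {V : W → Type} [∀ w, TopologicalSpace (V w)] {TJ TM : Type} [TopologicalSpace TJ] [TopologicalSpace TM]
  {C : ATS3.TensorPacketLociDatum W V TJ TM}

/-- **At PRINT's (Ind2), `^{n,∘}𝒰_{j,v_ℚ}` of the honest setting IS the (Ind3)-region in every packet.** [claim: Mochizuki2012, status: disputed] -/
theorem thetaHull_honestSetting_ismPrint (j : (thetaIndex X).Label) (vQ : (thetaIndex X).VQ) :
    (honestSetting X hlog stripAutDH (ismPrint logv) refl_mem_stripAutDH (refl_mem_ismPrint logv) M archPk archSub Ψ act Mmod region col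
        n p).thetaHull j vQ =
      (honestSetting X hlog stripAutDH (ismPrint logv) refl_mem_stripAutDH (refl_mem_ismPrint logv) M archPk archSub Ψ act Mmod region
        col n p).thetaRegion3 j vQ :=
  thetaHull_honestSetting_of_unitIsm X hlog refl_mem_stripAutDH (refl_mem_ismPrint logv) M archPk archSub Ψ act Mmod region col n p
    (fun _ _ hg => hg) (fun pp x => PinsInhabited.presented_unit_of_ismPrint X hlog pp x) j vQ

/-- **Y-11 hull reading at PRINT's (Ind2): ALL THREE rows, and the reading exists** — there hull reading = Θ-reading = orbit reading.
[claim: Joshi2024ATS3, status: disputed] [claim: Mochizuki2012, status: disputed] -/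
theorem exists_hullReading_all_honestSetting_ismPrint
    (𝔇 : Dictionary (latticeSituationReal X hlog stripAutDH (ismPrint logv) refl_mem_stripAutDH (refl_mem_ismPrint logv) M archPk
      archSub Ψ act Mmod region col)) :
    ∃ (hne : ∀ (j : (thetaIndex X).Label) (vQ : (thetaIndex X).VQ),
        ((honestSetting X hlog stripAutDH (ismPrint logv) refl_mem_stripAutDH (refl_mem_ismPrint logv) M archPk archSub Ψ act Mmod
          region col n p).thetaHull j vQ).Nonempty)
      (R : LociReading
        (honestSetting X hlog stripAutDH (ismPrint logv) refl_mem_stripAutDH (refl_mem_ismPrint logv) M archPk archSub Ψ act Mmod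
          region col n p)
        (regionLoci
          (latticeSituationReal X hlog stripAutDH (ismPrint logv) refl_mem_stripAutDH (refl_mem_ismPrint logv) M archPk archSub Ψ
            act Mmod region col) _ hne) 𝔇),
      R.LocusWithinPossibleImages ∧ R.PossibleImagesWithinLocus ∧ R.LocusWithinHull :=
  exists_hullReading_all_honestSetting_of_unitIsm X hlog refl_mem_stripAutDH (refl_mem_ismPrint logv) M archPk archSub Ψ act Mmod
    region col n p (fun _ _ hg => hg) (fun pp x => PinsInhabited.presented_unit_of_ismPrint X hlog pp x) 𝔇

end Print

end Summit.ABC.IUTFork.Joshi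

end
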